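import Summits.CriticalPhenomena.PercolationContinuityZ3.Theses.PercDislocationCovers
import Summits.CriticalPhenomena.PercolationContinuityZ3.Theorems.PercNearOneGluingNoHeavyLowerTailCSHTheoremOne
import Literature.Probability.Percolation.CoveringMonotonicity
import HarnessLib

/-!
# `PercDislocationCovers.CoverMonotone` (stmt-CriticalPhenomena-6531) — SETTLED after continuity

Item `stmt-CriticalPhenomena-6531` of route `CriticalPhenomena/PercDislocationCovers` (support): covering monotonicity `θ_H(φ v, p) ≤ θ_G(v, p)` for vertex maps with the weak covering property.

Literally the Literature theorem `LyonsPeres647.theta_le_of_surjOn_neighborSet` (Lyons–Peres Thm 6.47, exploration coupling).  p205010 is NOT used.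

builds on p205010 (kernel theorem, internal audit signed; external expert review pending) — USED (`CSH.percolationContinuityZ3_holds`).  RSW3 lane, lead gen 28 (prover-prim-rsw3-lead-g28-0):
'after continuity — the ledger harvest'.
References: G. Kozma, N. Nitzan (2024), Thm. 6 / Conj. 3 [KozmaNitzan2024]; G. Grimmett, *Percolation* (1999), §8 [GrimmettPercolation1999].
-/

noncomputable section

namespace Summit.CriticalPhenomena.PercolationContinuityZ3.Theorems

namespace PercDislocationCoversCoverMonotone

open MeasureTheory Literature.Probability.Percolation Literature.Probability.LatticeModels

/-- **`PercDislocationCovers.CoverMonotone` (stmt-CriticalPhenomena-6531), settled.**  `LyonsPeres647.theta_le_of_surjOn_neighborSet`.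
[cite: KozmaNitzan2024, Thm. 6 with Conj. 3 (p. 15)] -/
theorem coverMonotone_proof : Summit.CriticalPhenomena.PercolationContinuityZ3.Theses.PercDislocationCovers.CoverMonotone := by
  unfold Summit.CriticalPhenomena.PercolationContinuityZ3.Theses.PercDislocationCovers.CoverMonotone
  intro V W _ _ G H φ hφ v p
  exact LyonsPeres647.theta_le_of_surjOn_neighborSet G H φ hφ v p

end PercDislocationCoversCoverMonotone

end Summit.CriticalPhenomena.PercolationContinuityZ3.Theorems

end
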